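import Summits.CriticalPhenomena.Ising3DConformalLimit.Theorems.HarmonicMomentsIsotropyDilutionTransferLatticeSumsA
import Literature.Probability.LatticeModels.HighDimPointwiseTriviality

/-!
# Lattice sums as integrals over `ℝ³` (mesh cells), II: Riemann sums of the critical two-point function

Support file for item `DilutionTransfer` (stmt-CriticalPhenomena-6037) of route
`HarmonicMomentsIsotropy` (sub-problem `Ising3DConformalLimit`); continues `…LatticeSumsA`.

For a pointwise scaling limit `S` (renormalisation `ρ`) of the critical correlators of the `ℤ³`
Ising model (`HasPointwiseScalingLimit (criticalCorr 3) ρ S`):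
* `tendstoUniformlyOn_rescaled_twoPoint` — `ρ(δ)² ⟨σ₀σ_{[z/δ]}⟩_{β_c} → S₂(0, z)` uniformly on
  compact subsets of `ℝ³ ∖ {0}` (the `n = 2` clause at the pairs `(0, z)`);
* `limitTwoPoint_regular` — hence `z ↦ S₂(0,z)` is bounded, a.e.-measurable and integrable on such
  compacts;
* `volume_layer_le` — thin cubic layers `{c-δ < ‖z-w‖_∞ ≤ c+δ}` have volume `O(δ)`;
* `tendsto_rescaled_latticeSum` — **Riemann sums**: for cubic shells `U = {a < ‖z-w‖_∞ ≤ b}` whose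
  thickening avoids `0`, `δ³ρ(δ)² ∑_{x : δx ∈ U} ⟨σ₀σₓ⟩_{β_c} → ∫_U S₂(0,z) dz` as `δ → 0⁺`.

This is the Karamata/regular-variation input of the planner's sketch of the item ("every shell
carries a fixed fraction of the critical mass"), obtained here directly from the locally uniform
convergence in `HasPointwiseScalingLimit`. Elementary measure theory on top of Mathlib.
-/

noncomputable section

open MeasureTheory Filter Topology Set
open scoped ENNReal NNReal BigOperators
open Literature.Probability.LatticeModels

namespace Summit.CriticalPhenomena.Ising3DConformalLimit.Theorems.HarmonicMomentsIsotropy.LatticeSums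

/-! ## Uniform convergence of the rescaled critical two-point function on compacts avoiding `0` -/

/-- For a pointwise scaling limit `S` of the critical correlators, the rescaled critical two-point
function `z ↦ ρ(δ)² ⟨σ₀ σ_{[z/δ]}⟩_{β_c}` converges to `z ↦ S₂(0, z)` uniformly on every compact set of
`ℝ³` not containing the origin (the `n = 2` clause read at the pairs `(0, z)`). -/
theorem tendstoUniformlyOn_rescaled_twoPoint {ρ : ℝ → ℝ} {S : CorrFamily 3}
    (hlim : HasPointwiseScalingLimit (criticalCorr 3) ρ S) {K : Set (Fin 3 → ℝ)}
    (hK : IsCompact K) (h0 : (0 : Fin 3 → ℝ) ∉ K) :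
    TendstoUniformlyOn
      (fun δ z => ρ δ ^ 2 * criticalTwoPoint 3 (latticeApprox δ (WithLp.toLp 2 z)))
      (fun z : Fin 3 → ℝ => S 2 ![0, WithLp.toLp 2 z]) (𝓝[>] (0 : ℝ)) K := by
  set e : (Fin 3 → ℝ) → (Fin 2 → EuclideanSpace ℝ (Fin 3)) := fun z => ![0, WithLp.toLp 2 z]
    with he
  have hec : Continuous e := by
    refine continuous_const.matrixVecCons ?_
    exact (PiLp.continuous_toLp 2 _).matrixVecCons continuous_const
  have hK2 : IsCompact (e '' K) := hK.image hec
  have hK2s : e '' K ⊆ NonCoincident 3 2 := by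
    rintro _ ⟨z, hz, rfl⟩
    refine pair_mem_nonCoincident fun h => h0 ?_
    have : z = 0 := by
      have h' := congrArg (WithLp.ofLp) h
      simpa using h'.symm
    rwa [this] at hz
  have hU : TendstoUniformlyOn (rescaledCorrelator (criticalCorr 3) ρ 2) (S 2) (𝓝[>] 0) (e '' K) :=
    (tendstoLocallyUniformlyOn_iff_forall_isCompact (isOpen_nonCoincident 3 2)).1 (hlim 2)
      (e '' K) hK2s hK2
  have hU' := (hU.comp e).mono (fun z hz => ⟨z, hz, rfl⟩ : K ⊆ e ⁻¹' (e '' K))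
  refine hU'.congr (Eventually.of_forall fun δ => ?_)
  intro z _
  change rescaledCorrelator (criticalCorr 3) ρ 2 δ (e z) =
    ρ δ ^ 2 * criticalTwoPoint 3 (latticeApprox δ (WithLp.toLp 2 z))
  rw [rescaledCorrelator_apply, latticeApprox_comp_two, ← criticalCorr_two]
  have h0' : latticeApprox δ (e z 0) = 0 := by funext i; simp [he, latticeApprox_apply]
  have h1' : e z 1 = WithLp.toLp 2 z := by simp [he]
  rw [h0', h1']

/-- **Regularity of the limit two-point function on compacts avoiding `0`.** On a compact
`K ⊆ ℝ³ ∖ {0}` the limit `z ↦ S₂(0, z)` is bounded, a.e.-strongly measurable and integrable (as a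
uniform limit of the bounded measurable step functions `ρ(δ)²⟨σ₀σ_{[z/δ]}⟩_{β_c}`). -/
theorem limitTwoPoint_regular {ρ : ℝ → ℝ} {S : CorrFamily 3}
    (hlim : HasPointwiseScalingLimit (criticalCorr 3) ρ S) {K : Set (Fin 3 → ℝ)}
    (hK : IsCompact K) (h0 : (0 : Fin 3 → ℝ) ∉ K) :
    (∃ M : ℝ, ∀ z ∈ K, |S 2 ![0, WithLp.toLp 2 z]| ≤ M) ∧
      AEStronglyMeasurable (fun z : Fin 3 → ℝ => S 2 ![0, WithLp.toLp 2 z]) (volume.restrict K) ∧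
      IntegrableOn (fun z : Fin 3 → ℝ => S 2 ![0, WithLp.toLp 2 z]) K volume := by
  set g : (Fin 3 → ℝ) → ℝ := fun z => S 2 ![0, WithLp.toLp 2 z] with hg
  set F : ℝ → (Fin 3 → ℝ) → ℝ :=
    fun δ z => ρ δ ^ 2 * criticalTwoPoint 3 (latticeApprox δ (WithLp.toLp 2 z)) with hF
  have hKm : MeasurableSet K := hK.isClosed.measurableSet
  have hKfin : volume K < ⊤ := hK.measure_lt_top
  have hunif : TendstoUniformlyOn F g (𝓝[>] (0 : ℝ)) K :=
    tendstoUniformlyOn_rescaled_twoPoint hlim hK h0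
  have hFmeas : ∀ δ, Measurable (F δ) := fun δ =>
    measurable_const.mul ((measurable_of_countable _).comp (measurable_floorMap δ))
  have hFbd : ∀ δ z, |F δ z| ≤ ρ δ ^ 2 := fun δ z => by
    rw [hF]; dsimp only
    rw [abs_mul, abs_of_nonneg (sq_nonneg _)]
    refine mul_le_of_le_one_right (sq_nonneg _) ?_
    rw [abs_of_nonneg (criticalTwoPoint_nonneg' _)]
    exact criticalTwoPoint_le_one' _
  obtain ⟨M, hM⟩ : ∃ M : ℝ, ∀ z ∈ K, |g z| ≤ M := by
    have h1 := (Metric.tendstoUniformlyOn_iff.1 hunif) 1 one_pos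
    obtain ⟨δ₀, hδ₀⟩ := h1.exists
    refine ⟨ρ δ₀ ^ 2 + 1, fun z hz => ?_⟩
    have h := hδ₀ z hz
    rw [Real.dist_eq] at h
    have := hFbd δ₀ z
    rw [abs_le] at this ⊢
    constructor <;> linarith [(abs_lt.1 h).1, (abs_lt.1 h).2]
  have hgK : AEStronglyMeasurable g (volume.restrict K) := by
    refine aestronglyMeasurable_of_tendsto_ae (𝓝[>] (0 : ℝ)) (fun δ => (hFmeas δ).aestronglyMeasurable)
      ?_
    rw [ae_restrict_iff' hKm]
    exact Eventually.of_forall fun z hz => hunif.tendsto_at hz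
  have hgintK : IntegrableOn g K volume := by
    refine ⟨hgK, HasFiniteIntegral.restrict_of_bounded M hKfin ?_⟩
    rw [ae_restrict_iff' hKm]
    exact Eventually.of_forall fun z hz => by rw [Real.norm_eq_abs]; exact hM z hz
  exact ⟨⟨M, hM⟩, hgK, hgintK⟩

/-! ## Volumes of cubic layers -/

/-- The cubic layer `{c - δ < ‖z - w‖ ≤ c + δ}` has volume `≤ 64 (|c|+1)² δ` for `0 < δ ≤ 1`. -/
theorem volume_layer_le (w : Fin 3 → ℝ) (c : ℝ) {δ : ℝ} (hδ : 0 < δ) (hδ1 : δ ≤ 1) :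
    (volume (Metric.closedBall w (c + δ) \ Metric.closedBall w (c - δ))).toReal ≤
      64 * (|c| + 1) ^ 2 * δ := by
  have hcabs : c ≤ |c| := le_abs_self c
  rcases lt_or_ge (c + δ) 0 with hneg | hpos
  · rw [Metric.closedBall_eq_empty.2 hneg, empty_sdiff, measure_empty, ENNReal.toReal_zero]
    positivity
  rcases lt_or_ge (c - δ) 0 with hneg' | hpos'
  · calc (volume (Metric.closedBall w (c + δ) \ Metric.closedBall w (c - δ))).toReal
        ≤ (volume (Metric.closedBall w (c + δ))).toReal := by
          exact ENNReal.toReal_mono (by rw [Real.volume_pi_closedBall _ hpos]; exact ENNReal.ofReal_ne_top)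
            (measure_mono sdiff_subset)
      _ = (2 * (c + δ)) ^ 3 := by
          rw [Real.volume_pi_closedBall _ hpos, Fintype.card_fin, ENNReal.toReal_ofReal (by positivity)]
      _ ≤ (2 * (2 * δ)) ^ 3 := by gcongr; linarith
      _ = 64 * δ ^ 2 * δ := by ring
      _ ≤ 64 * (|c| + 1) ^ 2 * δ := by
          gcongr
          nlinarith [abs_nonneg c]
  · rw [measure_sdiff (Metric.closedBall_subset_closedBall (by linarith))
      measurableSet_closedBall.nullMeasurableSet
      (by rw [Real.volume_pi_closedBall _ hpos']; exact ENNReal.ofReal_ne_top),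
      Real.volume_pi_closedBall _ hpos, Real.volume_pi_closedBall _ hpos', Fintype.card_fin,
      ENNReal.toReal_sub_of_le (ENNReal.ofReal_le_ofReal (by gcongr; linarith)) ENNReal.ofReal_ne_top,
      ENNReal.toReal_ofReal (by positivity), ENNReal.toReal_ofReal (by positivity)]
    have hc0 : 0 ≤ c := by linarith
    rw [abs_of_nonneg hc0]
    have e1 : (2 * (c + δ)) ^ 3 - (2 * (c - δ)) ^ 3 = 48 * c ^ 2 * δ + 16 * δ ^ 3 := by ring
    rw [e1]
    have h3 : δ ^ 3 ≤ δ := by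
      have : δ ^ 3 ≤ δ ^ 1 := pow_le_pow_of_le_one hδ.le hδ1 (by norm_num)
      rwa [pow_one] at this
    nlinarith [mul_nonneg (sq_nonneg c) hδ.le, mul_nonneg hc0 hδ.le, h3]

/-! ## The Riemann-sum limit for cubic shells -/

open scoped Classical in
/-- **Riemann sums of the critical two-point function over cubic shells.** Let `S` be a pointwise
scaling limit of the critical correlators with renormalisation `ρ`, `w ∈ ℝ³`, `a < b`, and `η > 0`
with the thickened shell `{a - η ≤ ‖z - w‖_∞ ≤ b + η}` avoiding the origin. Then, with
`U = {a < ‖z - w‖_∞ ≤ b}`,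
`δ³ ρ(δ)² ∑_{x ∈ ℤ³ : δx ∈ U} ⟨σ₀σₓ⟩_{β_c} → ∫_U S₂(0, z) dz` as `δ → 0⁺`. -/
theorem tendsto_rescaled_latticeSum {ρ : ℝ → ℝ} {S : CorrFamily 3}
    (hlim : HasPointwiseScalingLimit (criticalCorr 3) ρ S) (w : Fin 3 → ℝ) {a b η : ℝ}
    (hη : 0 < η) (h0 : b + η < ‖w‖ ∨ ‖w‖ + η < a) :
    Tendsto (fun δ : ℝ => δ ^ 3 * ρ δ ^ 2 *
        ∑' x : Site 3, (if (δ • fun i => ((x i : ℤ) : ℝ)) ∈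
            Metric.closedBall w b \ Metric.closedBall w a then criticalTwoPoint 3 x else 0))
      (𝓝[>] (0 : ℝ))
      (𝓝 (∫ z in Metric.closedBall w b \ Metric.closedBall w a, S 2 ![0, WithLp.toLp 2 z])) := by
  -- notation
  set U : Set (Fin 3 → ℝ) := Metric.closedBall w b \ Metric.closedBall w a with hU
  set K : Set (Fin 3 → ℝ) := Metric.closedBall w (b + η) ∩ {z | a - η ≤ ‖z - w‖} with hK
  set g : (Fin 3 → ℝ) → ℝ := fun z => S 2 ![0, WithLp.toLp 2 z] with hg
  set fl : ℝ → (Fin 3 → ℝ) → Site 3 := fun δ z => latticeApprox δ (WithLp.toLp 2 z) with hfl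
  set pt : ℝ → Site 3 → (Fin 3 → ℝ) := fun δ x => δ • fun i => ((x i : ℤ) : ℝ) with hpt
  set F : ℝ → (Fin 3 → ℝ) → ℝ := fun δ z => ρ δ ^ 2 * criticalTwoPoint 3 (fl δ z) with hF
  -- basic facts about `K`, `U`
  have hKc : IsCompact K :=
    (isCompact_closedBall w (b + η)).inter_right (isClosed_le continuous_const (by fun_prop))
  have hKm : MeasurableSet K := hKc.isClosed.measurableSet
  have h0K : (0 : Fin 3 → ℝ) ∉ K := by
    rintro ⟨h1, h2⟩
    rw [Metric.mem_closedBall, dist_zero_left] at h1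
    simp only [mem_setOf_eq, zero_sub, norm_neg] at h2
    rcases h0 with h | h <;> linarith
  have hUm : MeasurableSet U := measurableSet_closedBall.diff measurableSet_closedBall
  have hUK : U ⊆ K := by
    intro z hz
    rw [hU, Set.mem_sdiff, Metric.mem_closedBall, Metric.mem_closedBall, dist_eq_norm] at hz
    refine ⟨?_, ?_⟩
    · rw [Metric.mem_closedBall, dist_eq_norm]; linarith
    · simp only [mem_setOf_eq]; linarith
  have hUb : U ⊆ Metric.closedBall w b := sdiff_subset
  have hKfin : volume K < ⊤ := hKc.measure_lt_top
  -- uniform convergence on `K`, boundedness and measurability of `g` on `K`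
  have hunif : TendstoUniformlyOn F g (𝓝[>] (0 : ℝ)) K :=
    tendstoUniformlyOn_rescaled_twoPoint hlim hKc h0K
  have hFmeas : ∀ δ, Measurable (F δ) := fun δ =>
    measurable_const.mul ((measurable_of_countable _).comp (measurable_floorMap δ))
  have hFbd : ∀ δ z, |F δ z| ≤ ρ δ ^ 2 := fun δ z => by
    rw [hF]; dsimp only
    rw [abs_mul, abs_of_nonneg (sq_nonneg _)]
    refine mul_le_of_le_one_right (sq_nonneg _) ?_
    rw [abs_of_nonneg (criticalTwoPoint_nonneg' _)]
    exact criticalTwoPoint_le_one' _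
  obtain ⟨⟨M, hM⟩, hgK, hgintK⟩ := limitTwoPoint_regular hlim hKc h0K
  -- the rounded regions `U_δ = {z : δ[z/δ] ∈ U}`
  have hUδm : ∀ δ, MeasurableSet {z : Fin 3 → ℝ | pt δ (fl δ z) ∈ U} := fun δ => by
    have hm : Measurable fun z : Fin 3 → ℝ => pt δ (fl δ z) := by
      refine (continuous_const_smul δ |>.measurable).comp ?_
      exact (measurable_of_countable fun x : Site 3 => fun i => ((x i : ℤ) : ℝ)).comp
        (measurable_floorMap δ)
    exact hm hUm
  have hUδK : ∀ δ, 0 < δ → δ < η → {z : Fin 3 → ℝ | pt δ (fl δ z) ∈ U} ⊆ K := by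
    intro δ hδ hδη z hz
    have hnear : ‖pt δ (fl δ z) - z‖ ≤ δ := norm_smul_floorMap_sub_le hδ z
    simp only [mem_setOf_eq, hU, Set.mem_sdiff, Metric.mem_closedBall, dist_eq_norm, not_le] at hz
    have h1 : ‖z - w‖ ≤ ‖pt δ (fl δ z) - w‖ + ‖pt δ (fl δ z) - z‖ := by
      have := norm_sub_le_norm_sub_add_norm_sub z (pt δ (fl δ z)) w
      rw [norm_sub_rev z (pt δ (fl δ z))] at this
      linarith
    have h2 : ‖pt δ (fl δ z) - w‖ ≤ ‖pt δ (fl δ z) - z‖ + ‖z - w‖ :=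
      norm_sub_le_norm_sub_add_norm_sub _ _ _
    refine ⟨?_, ?_⟩
    · rw [Metric.mem_closedBall, dist_eq_norm]; linarith [hz.1]
    · simp only [mem_setOf_eq]; linarith [hz.2]
  -- the symmetric difference lies in two thin layers
  have hlayers : ∀ δ, 0 < δ →
      ({z : Fin 3 → ℝ | pt δ (fl δ z) ∈ U} \ U) ∪ (U \ {z | pt δ (fl δ z) ∈ U}) ⊆
        (Metric.closedBall w (a + δ) \ Metric.closedBall w (a - δ)) ∪
          (Metric.closedBall w (b + δ) \ Metric.closedBall w (b - δ)) := by
    intro δ hδ z hz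
    have hnear : ‖pt δ (fl δ z) - z‖ ≤ δ := norm_smul_floorMap_sub_le hδ z
    have h1 : ‖z - w‖ ≤ ‖pt δ (fl δ z) - w‖ + ‖pt δ (fl δ z) - z‖ := by
      have := norm_sub_le_norm_sub_add_norm_sub z (pt δ (fl δ z)) w
      rw [norm_sub_rev z (pt δ (fl δ z))] at this
      linarith
    have h2 : ‖pt δ (fl δ z) - w‖ ≤ ‖pt δ (fl δ z) - z‖ + ‖z - w‖ :=
      norm_sub_le_norm_sub_add_norm_sub _ _ _
    simp only [hU, mem_union, Set.mem_sdiff, mem_setOf_eq, Metric.mem_closedBall, dist_eq_norm, not_le,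
      not_and, not_lt] at hz ⊢
    rcases hz with ⟨⟨hr1, hr2⟩, hzU⟩ | ⟨⟨hz1, hz2⟩, hrU⟩
    · -- `z ∈ U_δ \ U`
      by_cases hzb : ‖z - w‖ ≤ b
      · have hza := hzU hzb
        left; exact ⟨by linarith, by linarith⟩
      · push Not at hzb
        right; exact ⟨by linarith, by linarith⟩
    · -- `z ∈ U \ U_δ`
      by_cases hrb : ‖pt δ (fl δ z) - w‖ ≤ b
      · have hra := hrU hrb
        left; exact ⟨by linarith, by linarith⟩
      · push Not at hrb
        right; exact ⟨by linarith, by linarith⟩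
  -- the main estimate
  rw [Metric.tendsto_nhdsWithin_nhds]
  intro ε hε
  set VK : ℝ := (volume K).toReal with hVK
  have hVK0 : 0 ≤ VK := ENNReal.toReal_nonneg
  set ε' : ℝ := ε / (2 * (VK + 1)) with hε'
  have hε'0 : 0 < ε' := by positivity
  obtain ⟨δ₁, hδ₁, hδ₁F⟩ : ∃ δ₁ > 0, ∀ δ, 0 < δ → δ < δ₁ → ∀ z ∈ K, |F δ z - g z| < ε' := by
    have h1 := (Metric.tendstoUniformlyOn_iff.1 hunif) ε' hε'0
    rw [eventually_nhdsWithin_iff, Metric.eventually_nhds_iff] at h1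
    obtain ⟨δ₁, hδ₁, h⟩ := h1
    refine ⟨δ₁, hδ₁, fun δ hδ hδδ₁ z hz => ?_⟩
    have := h (by rw [Real.dist_eq, sub_zero, abs_of_pos hδ]; exact hδδ₁) hδ z hz
    rwa [Real.dist_eq, abs_sub_comm] at this
  set Cl : ℝ := 64 * (|a| + 1) ^ 2 + 64 * (|b| + 1) ^ 2 with hCl
  have hCl0 : 0 < Cl := by positivity
  set δ₂ : ℝ := ε / (2 * (2 * (|M| + 1) * Cl)) with hδ₂
  have hδ₂0 : 0 < δ₂ := by positivity
  refine ⟨min (min δ₁ δ₂) (min η 1), by positivity, fun δ hδ hδd => ?_⟩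
  rw [mem_Ioi] at hδ
  rw [Real.dist_eq, sub_zero, abs_of_pos hδ] at hδd
  have hδ1 : δ < δ₁ := lt_of_lt_of_le hδd ((min_le_left _ _).trans (min_le_left _ _))
  have hδ2 : δ < δ₂ := lt_of_lt_of_le hδd ((min_le_left _ _).trans (min_le_right _ _))
  have hδη : δ < η := lt_of_lt_of_le hδd ((min_le_right _ _).trans (min_le_left _ _))
  have hδ1' : δ ≤ 1 := (lt_of_lt_of_le hδd ((min_le_right _ _).trans (min_le_right _ _))).le
  set Uδ : Set (Fin 3 → ℝ) := {z | pt δ (fl δ z) ∈ U} with hUδ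
  have hUδK' : Uδ ⊆ K := hUδK δ hδ hδη
  -- Step 1: the lattice sum is `∫_{U_δ} F_δ`
  have hsum : δ ^ 3 * ρ δ ^ 2 * ∑' x : Site 3, (if pt δ x ∈ U then criticalTwoPoint 3 x else 0) =
      ∫ z in Uδ, F δ z := by
    have h1 := tsum_ite_mem_eq_integral hδ hUb (criticalTwoPoint 3)
    rw [mul_comm (δ ^ 3), mul_assoc, h1, ← integral_const_mul, ← integral_indicator (hUδm δ)]
    congr 1
    funext z
    simp only [indicator, mem_setOf_eq, hF, hpt, hfl]
    split_ifs <;> ring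
  -- Step 2: compare `∫_{U_δ} F_δ` with `∫_{U_δ} g`
  have hFint : IntegrableOn (F δ) Uδ volume :=
    Measure.integrableOn_of_bounded (M := ρ δ ^ 2) ((measure_mono hUδK').trans_lt hKfin).ne
      (hFmeas δ).aestronglyMeasurable (Eventually.of_forall fun z => by
        rw [Real.norm_eq_abs]; exact hFbd δ z)
  have hgintUδ : IntegrableOn g Uδ volume := hgintK.mono_set hUδK'
  have hgintU : IntegrableOn g U volume := hgintK.mono_set hUK
  have hstep2 : |(∫ z in Uδ, F δ z) - ∫ z in Uδ, g z| ≤ ε' * VK := by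
    rw [← integral_sub hFint hgintUδ]
    have h := norm_setIntegral_le_of_norm_le_const ((measure_mono hUδK').trans_lt hKfin)
      (fun z hz => (le_of_lt (by rw [Real.norm_eq_abs]; exact hδ₁F δ hδ hδ1 z (hUδK' hz))))
      (f := fun z => F δ z - g z) (μ := volume)
    rw [Real.norm_eq_abs] at h
    refine h.trans (mul_le_mul_of_nonneg_left ?_ hε'0.le)
    exact ENNReal.toReal_mono hKfin.ne (measure_mono hUδK')
  -- Step 3: compare `∫_{U_δ} g` with `∫_U g`
  have hlayfin : volume ((Metric.closedBall w (a + δ) \ Metric.closedBall w (a - δ)) ∪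
      (Metric.closedBall w (b + δ) \ Metric.closedBall w (b - δ))) < ⊤ :=
    measure_union_lt_top (measure_ne_top_of_subset sdiff_subset
      (isCompact_closedBall _ _).measure_lt_top.ne |>.lt_top)
      (measure_ne_top_of_subset sdiff_subset (isCompact_closedBall _ _).measure_lt_top.ne |>.lt_top)
  have hlayvol : (volume ((Metric.closedBall w (a + δ) \ Metric.closedBall w (a - δ)) ∪
      (Metric.closedBall w (b + δ) \ Metric.closedBall w (b - δ)))).toReal ≤ Cl * δ := by
    calc _ ≤ (volume (Metric.closedBall w (a + δ) \ Metric.closedBall w (a - δ))).toReal +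
          (volume (Metric.closedBall w (b + δ) \ Metric.closedBall w (b - δ))).toReal := by
            rw [← ENNReal.toReal_add (measure_ne_top_of_subset sdiff_subset
                (isCompact_closedBall _ _).measure_lt_top.ne)
              (measure_ne_top_of_subset sdiff_subset (isCompact_closedBall _ _).measure_lt_top.ne)]
            exact ENNReal.toReal_mono (ENNReal.add_ne_top.2 ⟨measure_ne_top_of_subset sdiff_subset
                (isCompact_closedBall _ _).measure_lt_top.ne, measure_ne_top_of_subset sdiff_subset
                (isCompact_closedBall _ _).measure_lt_top.ne⟩) (measure_union_le _ _)
      _ ≤ 64 * (|a| + 1) ^ 2 * δ + 64 * (|b| + 1) ^ 2 * δ :=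
          add_le_add (volume_layer_le w a hδ hδ1') (volume_layer_le w b hδ hδ1')
      _ = Cl * δ := by rw [hCl]; ring
  have hbound_sdiff : ∀ A : Set (Fin 3 → ℝ), A ⊆ K →
      A ⊆ (Metric.closedBall w (a + δ) \ Metric.closedBall w (a - δ)) ∪
        (Metric.closedBall w (b + δ) \ Metric.closedBall w (b - δ)) →
      |∫ z in A, g z| ≤ |M| * (Cl * δ) := by
    intro A hAK hAL
    have h := norm_setIntegral_le_of_norm_le_const ((measure_mono hAK).trans_lt hKfin)
      (fun z hz => by rw [Real.norm_eq_abs]; exact (hM z (hAK hz)).trans (le_abs_self M))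
      (f := g) (μ := volume)
    rw [Real.norm_eq_abs] at h
    refine h.trans (mul_le_mul_of_nonneg_left ?_ (abs_nonneg M))
    exact (ENNReal.toReal_mono hlayfin.ne (measure_mono hAL)).trans hlayvol
  have hstep3 : |(∫ z in Uδ, g z) - ∫ z in U, g z| ≤ 2 * (|M| * (Cl * δ)) := by
    have hA := integral_inter_add_sdiff hUm hgintUδ      -- `∫_{Uδ ∩ U} + ∫_{Uδ \ U} = ∫_{Uδ}`
    have hB := integral_inter_add_sdiff (hUδm δ) hgintU  -- `∫_{U ∩ Uδ} + ∫_{U \ Uδ} = ∫_U`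
    rw [inter_comm] at hB
    have heq : (∫ z in Uδ, g z) - ∫ z in U, g z = (∫ z in Uδ \ U, g z) - ∫ z in U \ Uδ, g z := by
      rw [← hA, ← hB]; ring
    rw [heq]
    have hl := hlayers δ hδ
    have h1 := hbound_sdiff (Uδ \ U) (sdiff_subset.trans hUδK') (subset_union_left.trans hl)
    have h2 := hbound_sdiff (U \ Uδ) (sdiff_subset.trans hUK) (subset_union_right.trans hl)
    calc |(∫ z in Uδ \ U, g z) - ∫ z in U \ Uδ, g z|
        ≤ |∫ z in Uδ \ U, g z| + |∫ z in U \ Uδ, g z| := abs_sub _ _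
      _ ≤ |M| * (Cl * δ) + |M| * (Cl * δ) := add_le_add h1 h2
      _ = 2 * (|M| * (Cl * δ)) := by ring
  -- conclusion
  rw [Real.dist_eq]
  change |δ ^ 3 * ρ δ ^ 2 * (∑' x : Site 3, (if pt δ x ∈ U then criticalTwoPoint 3 x else 0)) -
    ∫ z in U, g z| < ε
  rw [hsum]
  have hε1 : ε' * VK ≤ ε / 2 * (VK / (VK + 1)) := by
    rw [hε']; apply le_of_eq; field_simp
  have hε1' : ε / 2 * (VK / (VK + 1)) < ε / 2 := by
    have : VK / (VK + 1) < 1 := by rw [div_lt_one (by positivity)]; linarith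
    nlinarith
  have hε2 : 2 * (|M| * (Cl * δ)) < ε / 2 := by
    have h := mul_lt_mul_of_pos_left hδ2 (by positivity : 0 < 2 * (|M| + 1) * Cl)
    have e2 : 2 * (|M| + 1) * Cl * δ₂ = ε / 2 := by rw [hδ₂]; field_simp
    rw [e2] at h
    have h' : 2 * (|M| * (Cl * δ)) ≤ 2 * (|M| + 1) * Cl * δ := by
      nlinarith [abs_nonneg M, hCl0.le, hδ.le, mul_nonneg hCl0.le hδ.le]
    linarith
  calc |(∫ z in Uδ, F δ z) - ∫ z in U, g z|
      ≤ |(∫ z in Uδ, F δ z) - ∫ z in Uδ, g z| + |(∫ z in Uδ, g z) - ∫ z in U, g z| := abs_sub_le _ _ _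
    _ ≤ ε' * VK + 2 * (|M| * (Cl * δ)) := add_le_add hstep2 hstep3
    _ < ε / 2 + ε / 2 := by linarith
    _ = ε := by ring

end Summit.CriticalPhenomena.Ising3DConformalLimit.Theorems.HarmonicMomentsIsotropy.LatticeSums

end
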